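import Summits.BirchSwinnertonDyer.BirchSwinnertonDyer.Theses.TameQuarticManinParity
import Literature.NumberTheory.EllipticCurves.GreenbergSelmerOrdinaryFiltrationProofs
import HarnessLib

/-!
# Route `TameQuarticManinParity`: FIN34b `NewformCoeffPrimesOverFinite` (stmt-BirchSwinnertonDyer-23840) BY NAME —
# only finitely many primes of the coefficient ring `𝓞_g` of a `Γ₁(M)`-newform contain a given `n ≠ 0`

Lead seat `cruxlead-stmt-BirchSwinnertonDyer-23367` (crux MS `TprimeIrrModThreeSaturation`, line `abelian-fixed-points`):
FIN34b is the second finiteness leaf of LINE 34 (G34 `congruentNewformCarriesTorsionRep_of_everywhere`, p681685).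
PROOF OVER LANDED THEOREMS: `K_g = coeffCharField g` is a number field (`numberField_coeffCharField_of_isNewform1`,
Deligne–Serre (2.7.2)–(2.7.3) proved in the tree), so `𝓞_g = coeffCharIntegers g = 𝓞_{K_g}` is a Dedekind domain
(Mathlib, transported along the definitional equality with `NumberField.RingOfIntegers`); a prime containing `n ≠ 0`
divides the nonzero ideal `(n)` (`Ideal.dvd_iff_le`), and a nonzero element of the unique-factorisation monoid of ideals
has finitely many divisors (Mathlib `UniqueFactorizationMonoid.fintypeSubtypeDvd`).
THEOREMS ONLY; no definition, no named fact, no `sorry`.  No summit is proved; BSD is NOT proved.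
-/

set_option autoImplicit false
-- D-0017: single-problem summit, so `Summit.BirchSwinnertonDyer.BirchSwinnertonDyer.…` repeats a namespace BY DESIGN.
set_option linter.dupNamespace false

noncomputable section

open scoped MatrixGroups ModularForm NumberField
open CongruenceSubgroup
open Literature.NumberTheory.EllipticCurves.ModularForms

namespace Summit.BirchSwinnertonDyer.BirchSwinnertonDyer.Theorems.TameQuarticManinParity

open Summit.BirchSwinnertonDyer.BirchSwinnertonDyer.Theses.TameQuarticManinParity

/-- In a Dedekind domain only finitely many prime ideals contain a given nonzero element (they divide the nonzero
principal ideal it generates). [folklore] -/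
theorem setOf_isPrime_mem_finite {R : Type*} [CommRing R] [IsDedekindDomain R] {x : R} (hx : x ≠ 0) :
    {𝔐 : Ideal R | 𝔐.IsPrime ∧ x ∈ 𝔐}.Finite := by
  classical
  have hI : Ideal.span {x} ≠ 0 := by
    rw [Ne, Ideal.zero_eq_bot, Ideal.span_singleton_eq_bot]
    exact hx
  haveI := UniqueFactorizationMonoid.fintypeSubtypeDvd (Ideal.span {x}) hI
  refine (Set.finite_range fun J : {J : Ideal R // J ∣ Ideal.span {x}} ↦ (J : Ideal R)).subset ?_
  rintro 𝔐 ⟨-, hx𝔐⟩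
  exact ⟨⟨𝔐, Ideal.dvd_iff_le.mpr ((Ideal.span_singleton_le_iff_mem _).mpr hx𝔐)⟩, rfl⟩

/-- **FIN34b `NewformCoeffPrimesOverFinite` BY NAME** (stmt-BirchSwinnertonDyer-23840): for a newform `g` on `Γ₁(M)` of
weight `2` and `n ≠ 0`, only finitely many prime ideals of `𝓞_g = coeffCharIntegers g` contain `n` — `K_g` is a number
field (Deligne–Serre (2.7.3), `numberField_coeffCharField_of_isNewform1`), `𝓞_g = 𝓞_{K_g}` is a Dedekind domain of
characteristic `0`, and `setOf_isPrime_mem_finite`. [cite: DeligneSerreASENS1974, Prop. 2.7 (2.7.3) (p. 512)] -/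
theorem newformCoeffPrimesOverFinite_proof : NewformCoeffPrimesOverFinite := by
  intro M _ g hg n hn
  haveI : NumberField (coeffCharField g) :=
    Literature.NumberTheory.EllipticCurves.GreenbergSelmer.numberField_coeffCharField_of_isNewform1 hg
  haveI : IsDedekindDomain (coeffCharIntegers g) := inferInstanceAs (IsDedekindDomain (𝓞 (coeffCharField g)))
  have hx : ((n : ℕ) : coeffCharIntegers g) ≠ 0 := by
    exact_mod_cast hn
  exact setOf_isPrime_mem_finite hx

end Summit.BirchSwinnertonDyer.BirchSwinnertonDyer.Theorems.TameQuarticManinParity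

end
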